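import Mathlib
import Literature.Probability.Percolation.DiagonalStripQKZExact
import Literature.Probability.Percolation.DiagonalStripGroundStateSums
import HarnessLib

/-!
# The exact ground state: one entry point (IP12 §3.4 (20)–(22), §3.6 symmetry of `Z_L`)

Topic `Literature/Probability/Percolation`. Repackages `exists_groundState_qKZ_exact`
(`DiagonalStripQKZExact`) in the `IsExactExchange` language of `DiagonalStripPairingSymmetry` and
records the consequences for the sum `Z = Σ_Q ψ_Q` used by Ikhlef–Ponsaing (J. Stat. Phys. 149 (2012),
arXiv:1202.5476) in the proof of Prop. 3.4 ("`Z_L` is a symmetric function, easily proven using the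
qKZ equation"): there is a primitive polynomial `t`-fixed vector `P` at width `m` (`L = 2m+1`) such that

* the bulk exchange relations hold EXACTLY at every level `1 ≤ i ≤ 2m` (`IsExactExchange`, joins at
  odd levels, isolations at even levels);
* both boundary reflections are monomial: `ι_L ψ = z_L^{2a} ψ`, `ι_1 ψ = z_1^{2a'} ψ`;
* consequently `Z = Σ_Q ψ_Q` is invariant under every `σ_i`, `1 ≤ i ≤ 2m`, and
  `ι_L Z = z_L^{2a} Z`, `ι_1 Z = z_1^{2a'} Z`.

## References

* Y. Ikhlef, A. K. Ponsaing, *Finite-size left-passage probability in percolation*, J. Stat. Phys.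
  149 (2012) 10–36, arXiv:1202.5476, §3.4 (20)–(22), proof of Prop. 3.4. [IkhlefPonsaing2012]
-/

namespace Literature.Probability.Percolation

open Finset Literature.Probability.LatticeModels Literature.Probability.LatticeModels.TemperleyLieb

section ExactGroundState

open MvPolynomial

variable {m : ℕ}

/-- **The exact ground state in the `IsExactExchange` language, with the symmetries of its sum.**
[cite: IkhlefPonsaing2012, §3.4 (20)–(22), Prop. 3.4 (proof)] -/
theorem exists_groundState_exact_symmetric {q : ℂ} (hq : q ^ 2 + q + 1 = 0) :
    ∃ (P : ColPattern m → MvPolynomial ℕ ℂ) (a a' : ℤ), PolyPrimitive P ∧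
      (∀ Q', ∑ Q, ipTransferMatrixW m (genC ℂ q) (genW ℂ) (genZ ℂ) Q Q' * toRF ℂ (P Q) = toRF ℂ (P Q')) ∧
      (∀ j' : Fin m, IsExactExchange q (2 * (j' : ℕ) + 1) (cpJoin (Fin.castSucc j') j'.succ) (fun Q => toRF ℂ (P Q))) ∧
      (∀ b0 : Fin m, IsExactExchange q (2 * (b0 : ℕ) + 2) (cpIsolate b0.succ) (fun Q => toRF ℂ (P Q))) ∧
      (∀ Q, genInv ℂ (2 * m + 1) (toRF ℂ (P Q)) = genZ ℂ (2 * m + 1) ^ (2 * a) * toRF ℂ (P Q)) ∧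
      (∀ Q, genInv ℂ 1 (toRF ℂ (P Q)) = genZ ℂ 1 ^ (2 * a') * toRF ℂ (P Q)) ∧
      (∀ i, 1 ≤ i → i ≤ 2 * m → genSwap ℂ i (ipZsum fun Q => toRF ℂ (P Q)) = ipZsum fun Q => toRF ℂ (P Q)) ∧
      genInv ℂ (2 * m + 1) (ipZsum fun Q => toRF ℂ (P Q)) = genZ ℂ (2 * m + 1) ^ (2 * a) * ipZsum (fun Q => toRF ℂ (P Q)) ∧
      genInv ℂ 1 (ipZsum fun Q => toRF ℂ (P Q)) = genZ ℂ 1 ^ (2 * a') * ipZsum (fun Q => toRF ℂ (P Q)) := by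
  obtain ⟨P, a, hprim, hP, hodd, heven, htop, a', hbot⟩ := exists_groundState_qKZ_exact (m := m) hq
  have hodd' : ∀ j' : Fin m, IsExactExchange q (2 * (j' : ℕ) + 1) (cpJoin (Fin.castSucc j') j'.succ)
      (fun Q => toRF ℂ (P Q)) := fun j' Q => hodd j' Q
  have heven' : ∀ b0 : Fin m, IsExactExchange q (2 * (b0 : ℕ) + 2) (cpIsolate b0.succ) (fun Q => toRF ℂ (P Q)) :=
    fun b0 Q => heven b0 Q
  refine ⟨P, a, a', hprim, hP, hodd', heven', htop, hbot, fun i hi1 hi2 => ?_, genInv_ipZsum_of_zpow htop,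
    genInv_ipZsum_of_zpow hbot⟩
  obtain ⟨k, hk | hk⟩ := Nat.even_or_odd' i
  · -- even level `i = 2k = 2 b0 + 2` with `b0 = k - 1 < m`
    have hk1 : 1 ≤ k := by omega
    have hb : k - 1 < m := by omega
    have := (heven' ⟨k - 1, hb⟩).genSwap_ipZsum hq
    have hidx : 2 * ((⟨k - 1, hb⟩ : Fin m) : ℕ) + 2 = i := by simp only; omega
    rwa [hidx] at this
  · -- odd level `i = 2k + 1` with `k < m`
    have hb : k < m := by omega
    have := (hodd' ⟨k, hb⟩).genSwap_ipZsum hq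
    have hidx : 2 * ((⟨k, hb⟩ : Fin m) : ℕ) + 1 = i := by simp only; omega
    rwa [hidx] at this

end ExactGroundState

end Literature.Probability.Percolation
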